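import Summits.AtomisticToContinuum.HydrodynamicLimit.Theses.ImplosionDichotomy
import Summits.AtomisticToContinuum.HydrodynamicLimit.Theorems.PolynomialCompression.Negative.PdeForm
import Literature.Analysis.FluidPDE.HardSphereAlexander
import Literature.Analysis.FunctionSpaces.TorusCalculusProofs
import Literature.Analysis.FunctionSpaces.TorusSpaceTime

/-!
# The athermal scaling symmetry of the hard-sphere Euler system, and the profile foliation of `DenseExcursion`

Support knowledge for the crux `ImplosionDichotomy.DenseExcursion` (stmt-AtomisticToContinuum-12586), from the standing
disprover's `Cruxes/DenseExcursion/Disproof.lean` §13 (gen 3). The typed pressure law `hsPressure σ ρ θ = ρθZ(ρσ³)` is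
LINEAR IN `θ` (hard spheres are athermal), so `IsHardSphereEulerSolution σ` keeps, for EVERY `σ` and with NO regularity
of `Z`, the exact symmetry `(ρ, u, θ)(t, x) ↦ (ρ, μu, μ²θ)(μt, x)` on `[0, T/μ)` (`athermal_scaling`: constant factors
pass through the junk-valued torus operators unconditionally), while the density-scaling symmetry of the polytropic
ideal gas (the one the route's self-similar implosions use) is broken at relative order `ρσ³` (Boyd–Ramsey–Baty,
arXiv:1707.03792: `K_S = p f(ρ)` is needed, and holds here with the density unscaled). Consequence: the crux's body
for given profiles is invariant under `(u₀, θ₀) ↦ (μu₀, μ²θ₀)` (`reachesPackingWith_athermal_scaling`; the data are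
re-pinned with the sibling crux's `PolynomialCompressionPDE.admissible_iff_data`: all three time-`0` slices of an
admissible solution are `(rhoLim (profileOf a₀) σ, u₀, θ₀)`, and `rhoLim` depends on `a₀` only).
refuter-cdisprove-stmt-AtomisticToContinuum-12586-g3-0.
-/

noncomputable section

namespace Summit.AtomisticToContinuum.HydrodynamicLimit.Theorems

open MeasureTheory Filter Set Topology
open scoped ENNReal InnerProductSpace
open Literature.MathematicalPhysics.KineticTheory Literature.Analysis.FluidPDE
open Literature.Analysis.FunctionSpaces

/-- The body of the crux `DenseExcursion` FOR GIVEN PROFILES `(a₀, θ₀, u₀)` at level `η` (verbatim inner part). -/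
def DenseExcursionReachesPackingWith (η : ℝ) (a₀ θ₀ : Literature.MathematicalPhysics.KineticTheory.T3 → ℝ) (u₀ : Literature.MathematicalPhysics.KineticTheory.T3 → Literature.MathematicalPhysics.KineticTheory.V3) : Prop :=
  ∀ σ₀ : ℝ, 0 < σ₀ → ∃ σ : ℝ, 0 < σ ∧ σ < σ₀ ∧ ∃ (T : ℝ) (ρ θ : ℝ → Literature.MathematicalPhysics.KineticTheory.T3 → ℝ) (u : ℝ → Literature.MathematicalPhysics.KineticTheory.T3 → Literature.MathematicalPhysics.KineticTheory.V3), Literature.MathematicalPhysics.KineticTheory.IsHardSphereEulerSolution σ T ρ u θ ∧ (∀ Φ : (N : ℕ) → Literature.Analysis.FluidPDE.HardSphereFlow (Literature.Analysis.FluidPDE.Torus.geometry (Fin 3)) (Literature.MathematicalPhysics.KineticTheory.hsDiameter σ N) (N + 1), Literature.MathematicalPhysics.KineticTheory.TendstoHydroFieldsAt (fun N => Literature.MathematicalPhysics.KineticTheory.localGibbsLaw σ a₀ u₀ θ₀ N (Φ N)) Φ ρ u θ 0) ∧ ∃ t ∈ Set.Ico 0 T, ∃ x, η ≤ ρ t x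 * σ ^ 3

/-- The crux is `∃ η > 0, ∃ continuous positive profiles, DenseExcursionReachesPackingWith η a₀ θ₀ u₀` (definitional). -/
theorem denseExcursion_iff_reachesPackingWith :
    Summit.AtomisticToContinuum.HydrodynamicLimit.Theses.ImplosionDichotomy.DenseExcursion ↔
      ∃ η : ℝ, 0 < η ∧ ∃ (a₀ θ₀ : Literature.MathematicalPhysics.KineticTheory.T3 → ℝ) (u₀ : Literature.MathematicalPhysics.KineticTheory.T3 → Literature.MathematicalPhysics.KineticTheory.V3), Continuous a₀ ∧ Continuous θ₀ ∧ Continuous u₀ ∧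
        (∀ x, 0 < a₀ x) ∧ (∀ x, 0 < θ₀ x) ∧ DenseExcursionReachesPackingWith η a₀ θ₀ u₀ :=
  Iff.rfl

namespace DenseExcursionAthermalScaling

/-- Constant factors pass through `Torus.partialDeriv` UNCONDITIONALLY (junk included). [folklore] -/

theorem partialDeriv_const_smul {F : Type*} [NormedAddCommGroup F] [NormedSpace ℝ F] (c : ℝ) (f : T3 → F)
    (i : Fin 3) (x : T3) :
    Torus.partialDeriv i (fun y => c • f y) x = c • Torus.partialDeriv i f x := by
  unfold Torus.partialDeriv Torus.lineDeriv
  exact deriv_fun_const_smul_field c _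

/-- Scalar version of `partialDeriv_const_smul`. [folklore] -/
theorem partialDeriv_const_mul (c : ℝ) (f : T3 → ℝ) (i : Fin 3) (x : T3) :
    Torus.partialDeriv i (fun y => c * f y) x = c * Torus.partialDeriv i f x := by
  simpa only [smul_eq_mul] using partialDeriv_const_smul c f i x

/-- Constant factors pass through `Torus.divergence` unconditionally. [folklore] -/
theorem divergence_const_smul (c : ℝ) (v : T3 → V3) (x : T3) :
    Torus.divergence (fun y => c • v y) x = c * Torus.divergence v x := by
  unfold Torus.divergence
  rw [Finset.mul_sum]
  refine Finset.sum_congr rfl fun i _ => ?_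
  have e : (fun y => (c • v y) i) = fun y => c * v y i := by funext y; simp [PiLp.smul_apply]
  rw [e, partialDeriv_const_mul]

/-- Constant factors pass through `Torus.gradient` unconditionally (no regularity of the pressure slice is
needed). [folklore] -/
theorem gradient_const_mul (c : ℝ) (f : T3 → ℝ) (x : T3) :
    Torus.gradient (fun y => c * f y) x = c • Torus.gradient f x := by
  unfold Torus.gradient
  have e : Torus.liftAt (fun y => c * f y) x = c • Torus.liftAt f x := by
    funext v; simp [Torus.liftAt, smul_eq_mul]
  rw [e]
  unfold gradient
  rw [fderiv_const_smul_field]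
  simp

/-- `s ↦ μ s` maps `[0, T/μ)` into `[0, T)`. [folklore] -/
theorem mapsTo_mul_Ico {T μ : ℝ} (hμ : 0 < μ) : MapsTo (fun s : ℝ => μ * s) (Ico 0 (T / μ)) (Ico 0 T) := by
  intro s hs
  refine ⟨mul_nonneg hμ.le hs.1, ?_⟩
  have := hs.2
  rwa [lt_div_iff₀ hμ, mul_comm] at this

/-- Joint smoothness is preserved by the time rescaling `s ↦ μ s`. [folklore] -/
theorem isSmoothSpaceTimeOn_comp_mul {F : Type*} [NormedAddCommGroup F] [NormedSpace ℝ F] {T μ : ℝ}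
    {φ : ℝ → T3 → F} (hφ : Torus.IsSmoothSpaceTimeOn (Ico 0 T) φ) (hμ : 0 < μ) :
    Torus.IsSmoothSpaceTimeOn (Ico 0 (T / μ)) (fun s y => φ (μ * s) y) := by
  unfold Torus.IsSmoothSpaceTimeOn at hφ ⊢
  have e : Torus.stLift (fun s y => φ (μ * s) y) =
      Torus.stLift φ ∘ fun p : ℝ × EuclideanSpace ℝ (Fin 3) => (μ * p.1, p.2) := by
    funext p; rfl
  rw [e]
  refine hφ.comp (by fun_prop) ?_
  intro p hp
  exact mk_mem_prod (mapsTo_mul_Ico hμ (mem_prod.1 hp).1) (mem_univ _)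

/-- Chain rule for the one-sided time derivative under `s ↦ μ s`. [folklore] -/
theorem timeDerivWithin_comp_mul {F : Type*} [NormedAddCommGroup F] [NormedSpace ℝ F] {T μ : ℝ}
    {φ : ℝ → T3 → F} (hφ : Torus.IsSmoothSpaceTimeOn (Ico 0 T) φ) (hμ : 0 < μ) {t : ℝ}
    (ht : t ∈ Ico 0 (T / μ)) (x : T3) :
    Torus.timeDerivWithin (Ico 0 (T / μ)) (fun s y => φ (μ * s) y) t x =
      μ • Torus.timeDerivWithin (Ico 0 T) φ (μ * t) x := by
  have hμt : μ * t ∈ Ico 0 T := mapsTo_mul_Ico hμ ht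
  have h1 := hφ.hasDerivWithinAt_slice hμt x
  have h2 : HasDerivWithinAt (fun s : ℝ => μ * s) μ (Ico 0 (T / μ)) t := by
    simpa using ((hasDerivWithinAt_id t (Ico 0 (T / μ))).const_mul μ)
  have h := h1.scomp t h2 (mapsTo_mul_Ico hμ)
  unfold Torus.timeDerivWithin
  exact h.derivWithin (uniqueDiffOn_Ico 0 (T / μ) t ht)

/-- Chain rule with a constant factor. [folklore] -/
theorem timeDerivWithin_const_smul_comp_mul {F : Type*} [NormedAddCommGroup F] [NormedSpace ℝ F] {T μ : ℝ}
    {φ : ℝ → T3 → F} (hφ : Torus.IsSmoothSpaceTimeOn (Ico 0 T) φ) (hμ : 0 < μ) (c : ℝ) {t : ℝ}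
    (ht : t ∈ Ico 0 (T / μ)) (x : T3) :
    Torus.timeDerivWithin (Ico 0 (T / μ)) (fun s y => c • φ (μ * s) y) t x =
      (c * μ) • Torus.timeDerivWithin (Ico 0 T) φ (μ * t) x := by
  have h := timeDerivWithin_comp_mul hφ hμ ht x
  unfold Torus.timeDerivWithin at h ⊢
  rw [derivWithin_fun_const_smul_field c, h, smul_smul]

/-- **ATHERMAL SCALING SYMMETRY (EOS-free, every `σ`).** `(ρ, u, θ)(t, x) ↦ (ρ, μu, μ²θ)(μt, x)` maps classical
hard-sphere-Euler solutions on `[0,T)` to classical solutions on `[0, T/μ)`, for every `μ > 0` and every reduced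
diameter `σ`: the pressure law `p = ρθZ(ρσ³)` is linear in `θ` (athermal), so `p ↦ μ²p` with the density UNSCALED. [folklore] -/
theorem athermal_scaling {σ T : ℝ} {ρ θ : ℝ → T3 → ℝ} {u : ℝ → T3 → V3}
    (hE : IsHardSphereEulerSolution σ T ρ u θ) {μ : ℝ} (hμ : 0 < μ) :
    IsHardSphereEulerSolution σ (T / μ) (fun t x => ρ (μ * t) x) (fun t x => μ • u (μ * t) x)
      (fun t x => μ ^ 2 * θ (μ * t) x) where
  smooth_density := isSmoothSpaceTimeOn_comp_mul hE.smooth_density hμ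
  smooth_velocity := (isSmoothSpaceTimeOn_comp_mul hE.smooth_velocity hμ).const_smul μ
  smooth_temperature := by
    have h := (isSmoothSpaceTimeOn_comp_mul hE.smooth_temperature hμ).const_smul (μ ^ 2)
    simpa only [smul_eq_mul] using h
  density_pos := fun t ht x => hE.density_pos _ (mapsTo_mul_Ico hμ ht) x
  temperature_pos := fun t ht x => mul_pos (pow_pos hμ 2) (hE.temperature_pos _ (mapsTo_mul_Ico hμ ht) x)
  mass := by
    intro t ht x
    have hμt := mapsTo_mul_Ico hμ ht
    have hm := hE.mass _ hμt x
    rw [timeDerivWithin_comp_mul hE.smooth_density hμ ht x]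
    have e : (fun y => ρ (μ * t) y • μ • u (μ * t) y) = fun y => μ • (ρ (μ * t) y • u (μ * t) y) := by
      funext y; rw [smul_comm]
    rw [e, divergence_const_smul, smul_eq_mul]
    have : μ * (Torus.timeDerivWithin (Ico 0 T) ρ (μ * t) x +
        Torus.divergence (fun y => ρ (μ * t) y • u (μ * t) y) x) = 0 := by rw [hm, mul_zero]
    linarith [this]
  momentum := by
    intro t ht x
    have hμt := mapsTo_mul_Ico hμ ht
    have hm := hE.momentum _ hμt x
    have e1 : (fun s y => ρ (μ * s) y • μ • u (μ * s) y) = fun s y => μ • (ρ (μ * s) y • u (μ * s) y) := by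
      funext s y; rw [smul_comm]
    rw [e1, timeDerivWithin_const_smul_comp_mul (hE.smooth_density.smul hE.smooth_velocity) hμ μ ht x]
    have e2 : ∀ i : Fin 3, (fun y => (ρ (μ * t) y * (μ • u (μ * t) y) i) • μ • u (μ * t) y) =
        fun y => (μ * μ) • ((ρ (μ * t) y * u (μ * t) y i) • u (μ * t) y) := by
      intro i; funext y
      simp only [PiLp.smul_apply, smul_eq_mul, smul_smul]
      congr 1; ring
    have e3 : (∑ i, Torus.partialDeriv i (fun y => (ρ (μ * t) y * (μ • u (μ * t) y) i) • μ • u (μ * t) y) x) =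
        (μ * μ) • ∑ i, Torus.partialDeriv i (fun y => (ρ (μ * t) y * u (μ * t) y i) • u (μ * t) y) x := by
      rw [Finset.smul_sum]
      exact Finset.sum_congr rfl fun i _ => by rw [e2 i, partialDeriv_const_smul]
    rw [e3]
    have e4 : (fun y => hsPressure σ (ρ (μ * t) y) (μ ^ 2 * θ (μ * t) y)) =
        fun y => (μ * μ) * hsPressure σ (ρ (μ * t) y) (θ (μ * t) y) := by
      funext y; simp only [hsPressure]; ring
    rw [e4, gradient_const_mul]
    have : (μ * μ) • (Torus.timeDerivWithin (Ico 0 T) (fun s y => ρ s y • u s y) (μ * t) x +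
        (∑ i, Torus.partialDeriv i (fun y => (ρ (μ * t) y * u (μ * t) y i) • u (μ * t) y) x) +
        Torus.gradient (fun y => hsPressure σ (ρ (μ * t) y) (θ (μ * t) y)) x) = 0 := by
      rw [hm, smul_zero]
    rw [smul_add, smul_add] at this
    exact this
  energy := by
    intro t ht x
    have hμt := mapsTo_mul_Ico hμ ht
    have hen := hE.energy _ hμt x
    have eE : ∀ (r : ℝ) (v : V3) (q : ℝ), totalEnergyDensity r (μ • v) (μ ^ 2 * q) = (μ * μ) * totalEnergyDensity r v q := by
      intro r v q
      simp only [totalEnergyDensity, norm_smul, Real.norm_eq_abs, abs_of_pos hμ]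
      ring
    have e1 : (fun s y => totalEnergyDensity (ρ (μ * s) y) (μ • u (μ * s) y) (μ ^ 2 * θ (μ * s) y)) =
        fun s y => (μ * μ) • totalEnergyDensity (ρ (μ * s) y) (u (μ * s) y) (θ (μ * s) y) := by
      funext s y; rw [eE, smul_eq_mul]
    have hEn : Torus.IsSmoothSpaceTimeOn (Ico 0 T) fun s y => totalEnergyDensity (ρ s y) (u s y) (θ s y) := by
      have h1 : Torus.IsSmoothSpaceTimeOn (Ico 0 T) fun s y => ⟪u s y, u s y⟫_ℝ :=
        hE.smooth_velocity.inner hE.smooth_velocity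
      have h2 : Torus.IsSmoothSpaceTimeOn (Ico 0 T) fun s y => ‖u s y‖ ^ 2 / 2 + 3 / 2 * θ s y := by
        have e : (fun s y => ‖u s y‖ ^ 2 / 2 + 3 / 2 * θ s y) =
            fun s y => (1 / 2 : ℝ) • ⟪u s y, u s y⟫_ℝ + (3 / 2 : ℝ) • θ s y := by
          funext s y; rw [real_inner_self_eq_norm_sq]; simp only [smul_eq_mul]; ring
        rw [e]; exact (h1.const_smul _).add (hE.smooth_temperature.const_smul _)
      exact hE.smooth_density.mul h2
    rw [e1, timeDerivWithin_const_smul_comp_mul hEn hμ (μ * μ) ht x]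
    have e2 : (fun y => (totalEnergyDensity (ρ (μ * t) y) (μ • u (μ * t) y) (μ ^ 2 * θ (μ * t) y) +
          hsPressure σ (ρ (μ * t) y) (μ ^ 2 * θ (μ * t) y)) • μ • u (μ * t) y) =
        fun y => (μ * μ * μ) • ((totalEnergyDensity (ρ (μ * t) y) (u (μ * t) y) (θ (μ * t) y) +
          hsPressure σ (ρ (μ * t) y) (θ (μ * t) y)) • u (μ * t) y) := by
      funext y
      rw [eE]
      have ep : hsPressure σ (ρ (μ * t) y) (μ ^ 2 * θ (μ * t) y) = (μ * μ) * hsPressure σ (ρ (μ * t) y) (θ (μ * t) y) := by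
        simp only [hsPressure]; ring
      rw [ep, smul_smul, smul_smul]
      congr 1; ring
    rw [e2, divergence_const_smul]
    have : (μ * μ * μ) * (Torus.timeDerivWithin (Ico 0 T)
        (fun s y => totalEnergyDensity (ρ s y) (u s y) (θ s y)) (μ * t) x +
        Torus.divergence (fun y => (totalEnergyDensity (ρ (μ * t) y) (u (μ * t) y) (θ (μ * t) y) +
          hsPressure σ (ρ (μ * t) y) (θ (μ * t) y)) • u (μ * t) y) x) = 0 := by
      rw [hen, mul_zero]
    have e5 : (μ * μ * μ) • Torus.timeDerivWithin (Ico 0 T)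
        (fun s y => totalEnergyDensity (ρ s y) (u s y) (θ s y)) (μ * t) x =
        (μ * μ * μ) * Torus.timeDerivWithin (Ico 0 T)
        (fun s y => totalEnergyDensity (ρ s y) (u s y) (θ s y)) (μ * t) x := smul_eq_mul _ _
    rw [show (μ * μ * μ) = (μ * μ) * μ from rfl] at e5 this
    rw [e5]
    linarith [this]


end DenseExcursionAthermalScaling

open DenseExcursionAthermalScaling PolynomialCompressionPDE in
/-- **THE PROFILE FOLIATION** (EOS-free): `DenseExcursionReachesPackingWith η a₀ θ₀ u₀ →
DenseExcursionReachesPackingWith η a₀ (μ²θ₀) (μu₀)` for every `μ > 0` — rescale the witnesses by the athermal symmetry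
(`T ↦ T/μ`, excursion time `t ↦ t/μ`, packing unchanged) and re-pin the `t = 0` data: the old solution has slices
`(rhoLim, u₀, θ₀)`, the rescaled one `(rhoLim, μu₀, μ²θ₀)`, which is admissibility for the rescaled profiles (same
`a₀`, `admissible_iff_data` in both directions). [folklore] -/
theorem reachesPackingWith_athermal_scaling {η : ℝ} {a₀ θ₀ : T3 → ℝ} {u₀ : T3 → V3} (ha : Continuous a₀)
    (hθ : Continuous θ₀) (hu : Continuous u₀) (ha0 : ∀ x, 0 < a₀ x) (hθ0 : ∀ x, 0 < θ₀ x)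
    (h : DenseExcursionReachesPackingWith η a₀ θ₀ u₀) {μ : ℝ} (hμ : 0 < μ) :
    DenseExcursionReachesPackingWith η a₀ (fun x => μ ^ 2 * θ₀ x) (fun x => μ • u₀ x) := by
  have hθ' : Continuous fun x => μ ^ 2 * θ₀ x := continuous_const.mul hθ
  have hu' : Continuous fun x => μ • u₀ x := hu.const_smul μ
  have hθ0' : ∀ x, 0 < μ ^ 2 * θ₀ x := fun x => mul_pos (pow_pos hμ 2) (hθ0 x)
  obtain ⟨σ₁, hσ₁, -, G⟩ := admissible_iff_data ha hθ hu ha0 hθ0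
  obtain ⟨σ₂, hσ₂, -, G'⟩ := admissible_iff_data ha hθ' hu' ha0 hθ0'
  intro σ₀ hσ₀
  obtain ⟨σ, hσ, hσlt, T, ρ, θ, u, hE, hA, t, ht, x, hx⟩ :=
    h (min σ₀ (min σ₁ σ₂)) (lt_min hσ₀ (lt_min hσ₁ hσ₂))
  have h0 : σ < σ₀ := lt_of_lt_of_le hσlt (min_le_left _ _)
  have h1 : σ < σ₁ := lt_of_lt_of_le hσlt ((min_le_right _ _).trans (min_le_left _ _))
  have h2 : σ < σ₂ := lt_of_lt_of_le hσlt ((min_le_right _ _).trans (min_le_right _ _))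
  have hT : 0 < T := ht.1.trans_lt ht.2
  obtain ⟨hρc, huc, hθc⟩ := continuous_slices_zero hE hT
  obtain ⟨-, G1⟩ := G σ hσ h1
  obtain ⟨hρ0, hu0, hθ0e⟩ := (G1 ρ θ u hρc huc hθc).1 hA
  have hE' := athermal_scaling hE hμ
  refine ⟨σ, hσ, h0, T / μ, fun s y => ρ (μ * s) y, fun s y => μ ^ 2 * θ (μ * s) y,
    fun s y => μ • u (μ * s) y, hE', ?_, t / μ, ⟨div_nonneg ht.1 hμ.le, div_lt_div_of_pos_right ht.2 hμ⟩, x, ?_⟩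
  · obtain ⟨-, G2⟩ := G' σ hσ h2
    obtain ⟨hρc', huc', hθc'⟩ := continuous_slices_zero hE' (div_pos hT hμ)
    refine (G2 _ _ _ hρc' huc' hθc').2 ⟨?_, ?_, ?_⟩
    · funext y; show ρ (μ * 0) y = _; rw [mul_zero, hρ0]
    · funext y; show μ • u (μ * 0) y = μ • u₀ y; rw [mul_zero, hu0]
    · funext y; show μ ^ 2 * θ (μ * 0) y = μ ^ 2 * θ₀ y; rw [mul_zero, hθ0e]
  · have : μ * (t / μ) = t := mul_div_cancel₀ t hμ.ne'
    simp only [this]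
    exact hx

end Summit.AtomisticToContinuum.HydrodynamicLimit.Theorems

end
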